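import Summits.FinalStateConjecture.FinalStateConjecture.Theses.PhaseMixingCapture
import Summits.FinalStateConjecture.FinalStateConjecture.Theorems.BulkKerrCapture.Negative.SpinGapAndMass
import Literature.Geometry.Lorentzian.BondiMomentumCD
import Literature.Geometry.Lorentzian.StabilityCauchy
import HarnessLib.Audit

/-!
# Line `recoil-budget-modulus` — crux `BulkKerrCapture` (stmt-FinalStateConjecture-10696),
# route `PhaseMixingCapture`

CRUX-PLAN skeleton (planner `cruxplan-stmt-FinalStateConjecture-10696-recoil-budget-modulu`, round 1,
2026-08-16). Idea card `recoil-budget-modulus` (ideator 1), MERGED by all three triagers with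
`charges-pin-the-final-state` (ideator 2; same lever): **the crux's parameter modulus
`|M′ − M| + |a′ − a| ≤ C √dist` is a BUDGET at `𝓘⁺`, not a tracking estimate.** On the crux's data
ball (exponent `δ` chosen above the charge thresholds) every datum has the ADM charges of the centre
`Kerr.data M a M` exactly (`E_ADM = M`, `P_ADM = 0`: `stub_frozenCharges`); a maximal development
carries a canonical Bondi frame foliation whose FINAL REST MASS is the mass parameter `M′` of the
Kerr limit (`stub_bondiIdentification` — Hintz, arXiv:2606.28253, Conj. 13.8 and its second limit);
the radiated four-momentum is future causal, so the recoil costs at most what was radiated and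
`M − 2·E_rad ≤ M′ ≤ M − E_rad` (`restMass_pinch`, PROVED here from the tree's `IsCanonical` API);
the angular-momentum budget bounds `| |a′|M′ − |a|M |` (`stub_spinBudget`, Chen–Wang–Wang–Yau flux law
in deficit form: the tree has no angular momentum at `𝓘⁺` yet, and `ConvergesToKerr` is blind to the
SIGN of the spin parameter — Kerr `(M, a)` and `(M, −a)` are isometric by a reflection through a plane
containing the axis — so only the magnitude is a budget quantity); and the one dynamical scalar is the
flux bound `E_rad ≤ C_E √dist` (`stub_energyFluxSmall`, expected `≲ dist²`: linear `𝓘⁺`-flux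
boundedness on exact sub-extremal Kerr plus a second-order remainder — the rate mechanism of
`charges-pin-the-final-state` (3), adopted per triage r1-1 sharpen (i)). The existence clauses of the
crux (far-complete `𝓘⁺`, a SUB-extremal Kerr limit, `ε` uniform on `|a| ≤ a₁M`) are the shared
UNIFORMITY line L1 of the triage (Hintz Thm. 13.1 + Rem. 13.2 at fixed inner radius `r = m₀ = M`, in
finite regularity, slice transfer, Lebesgue number — kernel-checked templates `firstLemmaC1_holds`
(Ideator1Sketch) / `bulk_of_locallyUniform` (SketchIdeator2/3)), vendored here WITHOUT ANY MODULUS as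
`stub_uniformQualCapture`, with the spin sign normalised (`0 ≤ a·a′`, free by the reflection).

Composition `BulkKerrCapture_of` (sorry-free): thresholds `max`ed, basins `min`ed, then
`restMass_pinch` + `spin_pinch` + one shrink of `ε` (so that `2·E_rad ≤ M/2`, i.e. `M′ ≥ M/2`) give the
crux's `C √dist` with `C = 2C_E + 2C_J/M + 4|a₁|C_E`. Exponent bookkeeping: every stub is stated in
THRESHOLD form (`∃ s₀ δ₀, ∀ s ≥ s₀, ∀ δ ≥ δ₀`, which each prover gets from the threshold case by
monotonicity of `dataWeightedSobolevEDist` in `(s, δ)`), and `k` as `∀ k` (producer) / `∃ k₀`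
(consumers, lowered by `Spacetime.ConvergesTo.of_le`), so no monotonicity lemma is needed here.

Disproof.lean (cdisprove cycles 1–2, v4) read: NO KILL. Honoured: `bulkCaptureFamily_false_without_spinGap`
— `a₁ < 1` is used at `stub_uniformQualCapture` (the Kerr limit is SUB-extremal: the vendored
theorem's conclusion, false at `a = M`) and at `stub_energyFluxSmall` / `stub_spinBudget` (flux
constants uniform only on compact spin sets: superradiant amplification and slow decay degenerate as
`|a| → M`); `bulkCaptureFamily_false_without_posMass` — `0 < M` throughout, `spin_pinch` divides by
`M′ ≥ M/2 > 0` and the shrink of `ε` is `(M/(4C_E))²`. Centre consistency (`captureAt_atKerrData`): at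
`dist = 0` all budgets vanish and the pinch returns `(M′, |a′|) = (M, |a|)`. No stub is an instance of
a landed Negative lemma (`Negative/SpinGapAndMass` imported below as the scratch check — its
`bulkKerrCapture_iff` is the composition's first step; `Negative/PointwiseVsUniform` read; every stub keeps `a₁ < 1`, `0 < M`, `r₀ = M`, far-origin completeness, existential
`s ≥ s₀` — cf. Disproof §5 (c)–(d)). `ledger negatives --problem FinalStateConjecture`: 0.
-/

noncomputable section

-- the crux-workfile namespace prescribed by the crux protocol repeats the summit name
set_option linter.dupNamespace false

namespace Summit.FinalStateConjecture.FinalStateConjecture.Cruxes.BulkKerrCapture.RecoilBudgetModulus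

open Set Filter Topology
open scoped Manifold ContDiff ENNReal
open Literature.Geometry.Lorentzian
open Summit.FinalStateConjecture.FinalStateConjecture.Theses.PhaseMixingCapture (BulkKerrCapture)
open Summit.FinalStateConjecture.FinalStateConjecture.Theorems.BulkKerrCapture

/-! ## Common vocabulary -/

section Vocabulary

variable [Kerr.Facts] [Kerr.SliceFacts]

/-- **Qualitative capture at `(s, δ, k, M, ε, a)`** — the conclusion block of the crux with the
modulus clause REMOVED and the spin sign NORMALISED: every vacuum-constraint solution `D` on
`Kerr.slice a M` within `H^s_δ`-distance `ε` of `Kerr.data M a M` has all its maximal vacuum Cauchy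
developments far-complete (`DataEmbedding.HasCompleteFutureNullInfinityFar`, = the crux's inlined
sojourn clause by `Negative.bulkKerrCapture_iff`), with a region converging in `Cᵏ` to a SUB-extremal
`g_{M′,a′}` whose spin parameter has the sign of `a` (`0 ≤ a·a′`; free, since `ConvergesToKerr` holds
for `(M′, a′)` iff it holds for `(M′, −a′)`: `g_{M,−a} = R^* g_{M,a}` for the reflection
`R(x, y, z) = (x, −y, z)` of the Kerr–Schild chart, which preserves `t*`, `r` and the exterior). -/
def QualCaptureAt (s : ℕ) (δ : ℝ) (k : ℕ) (M : ℝ) (hM : 0 < M) (ε a : ℝ) : Prop :=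
  ∀ (D : InitialDataSet 𝓘(ℝ, E3) (Kerr.slice a M)) [D.metric.HasLeviCivita],
    D.IsVacuumConstraintSolution →
    InitialDataSet.dataWeightedSobolevEDist s δ D (Kerr.data M a M hM.le) < ENNReal.ofReal ε →
    ∀ 𝒟 : VacuumCauchyDevelopment D, 𝒟.IsMaximal →
      ∃ (M' a' : ℝ) (𝒟oc : Set 𝒟.carrier), Kerr.IsSubextremal M' a' ∧ 0 ≤ a * a' ∧
        𝒟.HasCompleteFutureNullInfinityFar ∧ 𝒟.toSpacetime.ConvergesToKerr 𝒟oc M' a' k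

/-- **The ball hypothesis as a predicate on developments' data**: `D` solves the vacuum constraints
and lies within `H^s_δ`-distance `ε` of `Kerr.data M a M`. (Abbreviation used by the four budget
stubs; unfolded definitionally.) -/
def InBall (s : ℕ) (δ : ℝ) (M : ℝ) (hM : 0 < M) (ε a : ℝ)
    (D : InitialDataSet 𝓘(ℝ, E3) (Kerr.slice a M)) [D.metric.HasLeviCivita] : Prop :=
  D.IsVacuumConstraintSolution ∧
    InitialDataSet.dataWeightedSobolevEDist s δ D (Kerr.data M a M hM.le) < ENNReal.ofReal ε

/-- The square-root size of a datum in the ball: `√dist(D, Kerr.data M a M)` (the crux's modulus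
variable). -/
def sqrtDist (s : ℕ) (δ : ℝ) (M : ℝ) (hM : 0 < M) (a : ℝ)
    (D : InitialDataSet 𝓘(ℝ, E3) (Kerr.slice a M)) : ℝ :=
  √(InitialDataSet.dataWeightedSobolevEDist s δ D (Kerr.data M a M hM.le)).toReal

end Vocabulary

/-! ## The kinematic core (PROVED): recoil pinning of the rest mass, spin pinning -/

section Kinematics

universe u

variable {X : Type u} [TopologicalSpace X] [ChartedSpace E3 X] [IsManifold (𝓡 3) ∞ X]
  [ConnectedSpace X] {D : InitialDataSet (𝓡 3) X}

/-- **Recoil pinning (PROVED from the tree's Bondi four-momentum API; card `recoil-budget-modulus`,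
first lemma).** For a Cauchy development carrying a canonical Bondi frame foliation
(`BondiMomentumCD.lean`: future-causal four-momentum loss, positivity, ADM limits) of data with
vanishing ADM momentum, the final Bondi REST mass is pinned by the radiated energy
`E_rad = E_ADM − E_B(+∞)` alone: `E_ADM − 2·E_rad ≤ M_B(+∞) ≤ E_ADM − E_rad` — the recoil of the final
black hole costs at most what was radiated (reverse triangle inequality for future-causal vectors).
Hintz, arXiv:2606.28253, (13.12) `m cosh χ ≤ m₀` is the upper half. -/
theorem restMass_pinch {𝒟 : CauchyDevelopment D} {𝓕 : 𝒟.BondiFrameFoliation} {e : AFEnd X}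
    (hc : 𝓕.IsCanonical e) (hP : AFEnd.admMomentumVec e D = 0) :
    AFEnd.admEnergy e D - 2 * (AFEnd.admEnergy e D - 𝓕.finalBondiEnergy) ≤ 𝓕.finalBondiRestMass ∧
      𝓕.finalBondiRestMass ≤ AFEnd.admEnergy e D - (AFEnd.admEnergy e D - 𝓕.finalBondiEnergy) := by
  set E := AFEnd.admEnergy e D with hE
  set Ef := 𝓕.finalBondiEnergy with hEf
  set Pf := 𝓕.finalBondiMomentum with hPf
  -- the radiated four-momentum is future causal: ‖P_f‖ = ‖P_ADM − P_f‖ ≤ E − E_f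
  have h1 : ‖Pf‖ ≤ E - Ef := by
    have hA := hc.norm_admMomentumVec_sub_bondiMomentum_le 0
    have hB := hc.norm_bondiMomentum_sub_finalBondiMomentum_le 0
    have htri : ‖AFEnd.admMomentumVec e D - Pf‖ ≤
        ‖AFEnd.admMomentumVec e D - 𝓕.bondiMomentum 0‖ + ‖𝓕.bondiMomentum 0 - Pf‖ := by
      simpa [sub_add_sub_cancel] using
        norm_add_le (AFEnd.admMomentumVec e D - 𝓕.bondiMomentum 0) (𝓕.bondiMomentum 0 - Pf)
    have : ‖AFEnd.admMomentumVec e D - Pf‖ ≤ E - Ef := by linarith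
    simpa [hP] using this
  have hEf0 : 0 ≤ Ef := hc.finalBondiEnergy_nonneg
  have hEfE : Ef ≤ E := hc.finalBondiEnergy_le_admEnergy
  refine ⟨?_, ?_⟩
  · -- lower bound: 2 E_f − E ≤ √(E_f² − ‖P_f‖²)
    have hgoal : E - 2 * (E - Ef) = 2 * Ef - E := by ring
    rw [hgoal]
    show 2 * Ef - E ≤ √(Ef ^ 2 - ‖Pf‖ ^ 2)
    by_cases hpos : 2 * Ef - E ≤ 0
    · exact hpos.trans (Real.sqrt_nonneg _)
    · have hpos' : 0 ≤ 2 * Ef - E := le_of_lt (not_le.mp hpos)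
      have hPsq : ‖Pf‖ ^ 2 ≤ (E - Ef) ^ 2 := by
        have h0 : 0 ≤ ‖Pf‖ := norm_nonneg _
        nlinarith
      calc 2 * Ef - E = √((2 * Ef - E) ^ 2) := (Real.sqrt_sq hpos').symm
        _ ≤ √(Ef ^ 2 - ‖Pf‖ ^ 2) := Real.sqrt_le_sqrt (by nlinarith)
  · -- upper bound: M_B(+∞) ≤ E_B(+∞) = E − E_rad
    have : E - (E - Ef) = Ef := by ring
    rw [this]
    exact hc.finalBondiRestMass_le_finalBondiEnergy

/-- The rest-mass pinch in absolute-value form: with `E_ADM = M` and `M_B(+∞) = M′`,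
`|M′ − M| ≤ 2·E_rad` (and `E_rad ≥ 0`). -/
theorem abs_restMass_sub_le {𝒟 : CauchyDevelopment D} {𝓕 : 𝒟.BondiFrameFoliation} {e : AFEnd X}
    (hc : 𝓕.IsCanonical e) (hP : AFEnd.admMomentumVec e D = 0) {M M' : ℝ}
    (hE : AFEnd.admEnergy e D = M) (hrest : 𝓕.finalBondiRestMass = M') :
    |M' - M| ≤ 2 * (AFEnd.admEnergy e D - 𝓕.finalBondiEnergy) ∧
      0 ≤ AFEnd.admEnergy e D - 𝓕.finalBondiEnergy := by
  obtain ⟨hlo, hhi⟩ := restMass_pinch hc hP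
  have hrad : 0 ≤ AFEnd.admEnergy e D - 𝓕.finalBondiEnergy :=
    sub_nonneg.2 hc.finalBondiEnergy_le_admEnergy
  refine ⟨abs_le.2 ⟨?_, ?_⟩, hrad⟩
  · rw [← hrest, ← hE]; linarith
  · rw [← hrest, ← hE]; linarith

omit [TopologicalSpace X] [ChartedSpace E3 X] [IsManifold (𝓡 3) ∞ X] [ConnectedSpace X] in
/-- **Spin pinning (PROVED, real algebra; card `recoil-budget-modulus`).** If the rest mass is pinned,
`|m − M| ≤ 2E`, and the angular-momentum budget reads `|A'·m − A·M| ≤ J` (here `A = |a|`, `A' = |a'|`: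
magnitudes, the only budget quantities), then `|A' − A| ≤ (J + 2|A|E)/m`. -/
theorem spin_pinch {M m A A' E J : ℝ} (hm : 0 < m) (hmass : |m - M| ≤ 2 * E)
    (hJ : |A' * m - A * M| ≤ J) : |A' - A| ≤ (J + 2 * |A| * E) / m := by
  have hrepr : A' - A = ((A' * m - A * M) + A * (M - m)) / m := by
    field_simp
    ring
  rw [hrepr, abs_div, abs_of_pos hm]
  apply div_le_div_of_nonneg_right _ hm.le
  calc |A' * m - A * M + A * (M - m)| ≤ |A' * m - A * M| + |A * (M - m)| := abs_add_le _ _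
    _ ≤ J + 2 * |A| * E := by
        have h2 : |A * (M - m)| ≤ |A| * (2 * E) := by
          rw [abs_mul, abs_sub_comm]
          exact mul_le_mul_of_nonneg_left hmass (abs_nonneg A)
        linarith

omit [TopologicalSpace X] [ChartedSpace E3 X] [IsManifold (𝓡 3) ∞ X] [ConnectedSpace X] in
/-- Sign normalisation: if `a` and `a'` do not have opposite signs then `|a' − a| = ||a'| − |a||`, so a
budget on spin MAGNITUDES controls the crux's signed `|a' − a|`. -/
theorem abs_sub_eq_abs_abs_sub_abs {a a' : ℝ} (h : 0 ≤ a * a') : |a' - a| = |(|a'| - |a|)| := by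
  rcases le_total 0 a with ha | ha <;> rcases le_total 0 a' with ha' | ha'
  · rw [abs_of_nonneg ha, abs_of_nonneg ha']
  · have h0 : a * a' = 0 := le_antisymm (mul_nonpos_of_nonneg_of_nonpos ha ha') h
    rcases mul_eq_zero.1 h0 with rfl | rfl <;> simp
  · have h0 : a * a' = 0 := le_antisymm (mul_nonpos_of_nonpos_of_nonneg ha ha') h
    rcases mul_eq_zero.1 h0 with rfl | rfl <;> simp
  · rw [abs_of_nonpos ha, abs_of_nonpos ha', show a' - a = -(-a' - -a) by ring, abs_neg]

end Kinematics

/-! ## The stubs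

Each stub's statement is the `Prop` `Sig.stub_<name>` (its SIGNATURE) and the registered obligation
is `theorem stub_<name> : Sig.stub_<name> := by sorry`; the composition `BulkKerrCapture_of` takes the
five signatures as hypotheses BY NAME. Conventions shared by all five: the crux's own quantifier
prefix `∀ a₁ < 1 … ∀ M > 0 … ∀ |a| ≤ a₁ M`, the crux's data class (smooth vacuum-constraint solutions
on `Kerr.slice a M = {t* = 0, r > M}` at `H^s_δ`-distance `< ε` from `Kerr.data M a M`), its
developments (`VacuumCauchyDevelopment`, `IsMaximal`), and Sobolev exponents in THRESHOLD form. -/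

/-- **Stub U — uniform qualitative capture (the shared UNIFORMITY line L1; size XL as a
formalisation, "claimed in preprint + glue" mathematically).** For every `a₁ < 1` and every `k` there
are thresholds `(s₀, δ₀)` such that for all `s ≥ s₀`, `δ ≥ δ₀` and every `M > 0` ONE basin `ε > 0`
serves every spin `|a| ≤ a₁M`: `QualCaptureAt s δ k M hM ε a` (far-complete `𝓘⁺`, a region converging
in `Cᵏ` to a SUB-extremal `g_{M′,a′}`, `0 ≤ a·a′`) — the crux with its modulus clause deleted.
Route to it (triage r1, all three): vendor Hintz arXiv:2606.28253 Thm. 13.1 in the LOCAL,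
FINITE-REGULARITY form at fixed inner radius `r = m₀ = M` ((13.1a) with `H_b^{d′}` — [G1]: the
printed `H_b^∞` hypothesis covers no finite-`s` ball), basin-uniformity near each centre from
Rem. 13.2's second sentence (tail tolerance `r^{−1−δ}`: same-mass Kerr data of nearby spin differ by
`O(|a − a₀|)·r^{−2}, r^{−3}` terms inside (13.1a)), the slice transfer [S2] (the crux's leaf
`{t* = 0}` bends logarithmically below Hintz's `Σ_IVP`: an evolution lemma through the wedge),
conversion of rates (1)–(4) into `ConvergesToKerr` + far-sojourn completeness, `∀ k` by persistence of
regularity (`s₀ = s₀(k)`), and the Lebesgue-number step on `[−a₁, a₁] ⊂ (−1, 1)` (kernel-checked: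
`Ideator1.firstLemmaC1_holds`, `SketchIdeator2/3.bulk_of_locallyUniform`). Why it might fail: preprint
status of the full-range theorem; ε non-uniform on `|a| ≤ a₁M` at the fixed slice `r₀ = M` (collar
`r₊ − M ≥ M√(1 − a₁²)` keeps it inside `(r₋, r₊)`). NOT the crux: no modulus, different prefix. -/
def Sig.stub_uniformQualCapture : Prop :=
  ∀ [Kerr.Facts] [Kerr.SliceFacts], ∀ a₁ : ℝ, a₁ < 1 → ∀ k : ℕ, ∃ (s₀ : ℕ) (δ₀ : ℝ),
    ∀ (s : ℕ) (δ : ℝ), s₀ ≤ s → δ₀ ≤ δ → ∀ (M : ℝ) (hM : 0 < M), ∃ ε > (0 : ℝ),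
      ∀ a : ℝ, |a| ≤ a₁ * M → QualCaptureAt s δ k M hM ε a

/-- **Stub B — canonical Bondi frame and identification of the final rest mass (Hintz's Conj. 13.8
with both limits; size L).** For every `a₁ < 1` there are `k₀` and thresholds `(s₀, δ₀)` such that for
all `s ≥ s₀`, `δ ≥ δ₀`, every `M > 0`, some `ε > 0` and all `|a| ≤ a₁M`: every maximal vacuum Cauchy
development of a datum in the ball carries a Bondi frame foliation `𝓕` which is CANONICAL for the end
`Kerr.afEnd a M` (`BondiMomentumCD.IsCanonical`: Hawking energies/momenta converge along the outgoing
cones, four-momentum loss is future causal, positivity, `(E_B, P_B)(−∞) = (E_ADM, P_ADM)`) and whose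
FINAL REST MASS `√(E_B(+∞)² − ‖P_B(+∞)‖²)` equals the mass parameter `M′` of any sub-extremal Kerr
limit `ConvergesToKerr 𝒟oc M′ a′ k₀` of the development (the final hole is a Kerr `(M′, ±a′)` boosted
with rapidity `χ`: `E_B(+∞) = M′ cosh χ`, `‖P_B(+∞)‖ = M′ sinh χ` — Hintz (13.10)–(13.12); the rest
mass is Lorentz-invariant, so no frame or centre-of-mass information is needed). Content: Bondi–Sachs
structure on the polyhomogeneous `𝓘⁺` of the vendored development (Hintz–Vasy arXiv:1711.00195 §8 did
exactly this for Minkowski in the same calculus), ADM matching at `i⁰` (Ashtekar–Magnon-Ashtekar; uses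
Stub F's frozen charges), late-time convergence of the Bondi four-momentum to the final Kerr's, and
RIGIDITY OF THE KERR LIMIT (all Kerr limits of such a development at `k₀ ≥ 2` share `(M′, |a′|)` —
local Weyl-invariant characterisation of Kerr; `ConvergesToKerr` alone does not see the `1/r` mass
aspect). Why it might fail: open in the source ("We leave the investigation of Conjecture 13.8 … to
future work", p. 326); log terms at `ι⁺`; the tree's `IsCanonical` asks convergence of HAWKING
momenta of asymptotically round cone sections, to be matched with Bondi–Sachs cuts. -/
def Sig.stub_bondiIdentification : Prop :=
  ∀ [Kerr.Facts] [Kerr.SliceFacts], ∀ a₁ : ℝ, a₁ < 1 → ∃ (k₀ s₀ : ℕ) (δ₀ : ℝ),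
    ∀ (s : ℕ) (δ : ℝ), s₀ ≤ s → δ₀ ≤ δ → ∀ (M : ℝ) (hM : 0 < M), ∃ ε > (0 : ℝ),
      ∀ a : ℝ, |a| ≤ a₁ * M →
      ∀ (D : InitialDataSet 𝓘(ℝ, E3) (Kerr.slice a M)) [D.metric.HasLeviCivita],
        InBall s δ M hM ε a D → ∀ 𝒟 : VacuumCauchyDevelopment D, 𝒟.IsMaximal →
        ∀ (M' a' : ℝ) (𝒟oc : Set 𝒟.carrier), Kerr.IsSubextremal M' a' →
          𝒟.toSpacetime.ConvergesToKerr 𝒟oc M' a' k₀ →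
          ∃ 𝓕 : 𝒟.toCauchyDevelopment.BondiFrameFoliation,
            𝓕.IsCanonical (Kerr.afEnd a M) ∧ 𝓕.finalBondiRestMass = M'

/-- **Stub F — frozen charges (charge superselection of the ball; size M).** There are thresholds
`(s₀, δ₀)` (expected `s₀ = 3`, any `δ₀ > −1/2`: weighted Sobolev embedding gives `|∂f| = O(r^{−δ−5/2})`,
flux `O(r^{−δ−1/2}) → 0`) such that for all `s ≥ s₀`, `δ ≥ δ₀`, every `M > 0`,
every spin `a` and every vacuum-constraint solution `D` on `Kerr.slice a M` at FINITE `H^s_δ`-distance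
from `Kerr.data M a M`: the ADM energy of `D` on the end `Kerr.afEnd a M` is `M` and its ADM linear
momentum vanishes. Content: with the tree's weight `(1 + ‖x‖)^{2(δ+m)}` on `‖D^m f‖²` an `r^{−p}` tail
lies in `H⁰_δ` iff `p > δ + 3/2`, so for `δ > −1/2` the difference `h_D − h_Kerr` carries no `r^{−1}`
(mass) tail and `k_D − k_Kerr ∈ H^{s−1}_{δ+1}` no `r^{−2}` (momentum) tail; the ADM flux differences
through `S_r` tend to `0` (Cauchy–Schwarz on shells: `∫_{r>R}|DDf| < ∞` for `δ > −1/2`; a nonzero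
limit of `∮|Df|` would contradict `Df ∈ L²((1+r)^{2δ+2})`), and the charges of the centre are
`E_ADM = M`, `P_ADM = 0` (the UNPROVED named facts `Kerr.hasADMEnergy_data`,
`Kerr.hasADMMomentum_data_zero` — to be proved: flux of `h = δ + 2Hℓ⊗ℓ`, `H = Mr³/(r⁴ + a²z²)`).
Triage [δ]/F5 re-derived the thresholds; StabilityCauchy's docstring records the mass half. Why it
might fail: only through the tree's `admEnergy`/`admMomentum` being `limUnder`s — the stub includes
existence of the flux limits (Bartnik 1986 §4 needs `R(h) ∈ L¹`: the Hamiltonian constraint). -/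
def Sig.stub_frozenCharges : Prop :=
  ∀ [Kerr.Facts] [Kerr.SliceFacts], ∃ (s₀ : ℕ) (δ₀ : ℝ), ∀ (s : ℕ) (δ : ℝ), s₀ ≤ s → δ₀ ≤ δ →
    ∀ (M : ℝ) (hM : 0 < M) (a : ℝ),
    ∀ (D : InitialDataSet 𝓘(ℝ, E3) (Kerr.slice a M)) [D.metric.HasLeviCivita],
      D.IsVacuumConstraintSolution →
      InitialDataSet.dataWeightedSobolevEDist s δ D (Kerr.data M a M hM.le) < ⊤ →
      (Kerr.afEnd a M).admEnergy D = M ∧ AFEnd.admMomentumVec (Kerr.afEnd a M) D = 0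

/-- **Stub E — energy flux smallness (the line's DYNAMICAL input; size L; LOAD-BEARING).** For every
`a₁ < 1` there are thresholds `(s₀, δ₀)` such that for all `s ≥ s₀`, `δ ≥ δ₀`, every `M > 0`, some
`ε > 0`, some `C` and all `|a| ≤ a₁M`: for every maximal vacuum Cauchy development of a datum `D` in
the ball and EVERY canonical Bondi frame foliation `𝓕` for `Kerr.afEnd a M`, the total radiated energy
satisfies `E_ADM(D) − E_B(+∞) ≤ C · √dist(D, Kerr.data M a M)`. (All canonical foliations see the same
number: the frame is tied to the end by the `u → −∞` limits and the final four-momentum is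
cut-independent.) Expected truth is much stronger — `E_rad = ¼‖N‖²_{L²(𝓘⁺)} ≲ dist²`: news
`N = N_lin + N_rem` with `‖N_lin‖_{L²(𝓘⁺)} ≤ C_lin(a₁, M)·dist` by LINEAR `𝓘⁺`-flux boundedness on exact
sub-extremal Kerr (Teukolsky: Shlapentokh-Rothman–Teixeira da Costa arXiv:2007.07211/2302.08916,
Millet arXiv:2302.06946; scalar model DRSR arXiv:1402.7034 Thm. 3.1) and a second-order remainder;
the `√` leaves `dist^{3/2}` of slack, so any Hölder exponent `≥ 1/4` for data ↦ news suffices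
(Taylor at the centre, or interpolation of a weak Lipschitz difference estimate with strong a-priori
bounds). Why it might fail: the remainder needs `C²`/difference control of data ↦ radiation field on
the basin, uniformly on `|a| ≤ a₁M` (unprinted for the vacuum system; boundedness-tier but nonlinear);
constants degenerate as `a₁ → 1` (allowed). Superradiance is met, not evaded: the linear flux constant
exceeds `1` but is finite on compact sub-extremal spin sets. -/
def Sig.stub_energyFluxSmall : Prop :=
  ∀ [Kerr.Facts] [Kerr.SliceFacts], ∀ a₁ : ℝ, a₁ < 1 → ∃ (s₀ : ℕ) (δ₀ : ℝ),
    ∀ (s : ℕ) (δ : ℝ), s₀ ≤ s → δ₀ ≤ δ → ∀ (M : ℝ) (hM : 0 < M), ∃ ε > (0 : ℝ), ∃ C : ℝ,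
      ∀ a : ℝ, |a| ≤ a₁ * M →
      ∀ (D : InitialDataSet 𝓘(ℝ, E3) (Kerr.slice a M)) [D.metric.HasLeviCivita],
        InBall s δ M hM ε a D → ∀ 𝒟 : VacuumCauchyDevelopment D, 𝒟.IsMaximal →
        ∀ 𝓕 : 𝒟.toCauchyDevelopment.BondiFrameFoliation, 𝓕.IsCanonical (Kerr.afEnd a M) →
          (Kerr.afEnd a M).admEnergy D - 𝓕.finalBondiEnergy ≤ C * sqrtDist s δ M hM a D

/-- **Stub J — the angular-momentum budget in deficit form (size L).** For every `a₁ < 1` there are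
`k₀` and thresholds `(s₀, δ₀)` (expected `δ₀ > 1/2`: the angular-momentum / centre tails `k ∼ r^{−3}`,
`h ∼ r^{−2}` freeze iff `δ > 1/2`) such that for all `s ≥ s₀`, `δ ≥ δ₀`, every `M > 0`, some `ε > 0`,
some `C` and all `|a| ≤ a₁M`: for every maximal vacuum Cauchy development of a datum in the ball and
every sub-extremal Kerr limit `ConvergesToKerr 𝒟oc M′ a′ k₀`, the spin MAGNITUDES obey
`| |a′|·M′ − |a|·M | ≤ C · √dist`. This is the Chen–Wang–Wang–Yau budget `J⃗_f = J⃗_ADM − J⃗_rad` read in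
magnitudes: `J⃗_ADM = aM ẑ` is frozen on the ball, `|J⃗_f| = |a′|M′` is the intrinsic spin of the final
Kerr (supertranslation-invariant, centre-of-mass–corrected CWY angular momentum of a boosted,
translated Kerr; the orbital term `D⃗ × P⃗_f` is `O(dist⁴)`, triage r1-2), and `|J⃗_rad| ≲
‖shear‖‖news‖ ≲ dist²` by the CWY flux law — typed in deficit form because the tree has no angular
momentum at `𝓘⁺` yet (definition request D1 of card `charges-pin-the-final-state`), and in MAGNITUDE
form because the sign of `a′` is invisible to `ConvergesToKerr` (reflection symmetry). Why it might
fail: angular momentum at `𝓘⁺` on dynamical black-hole spacetimes with Hintz's log terms at `ι⁺` is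
the least developed piece in print (supertranslation ambiguity: CWY's invariance needs their decay
class); rigidity of the Kerr limit as in Stub B; flux constants degenerate as `a₁ → 1`. -/
def Sig.stub_spinBudget : Prop :=
  ∀ [Kerr.Facts] [Kerr.SliceFacts], ∀ a₁ : ℝ, a₁ < 1 → ∃ (k₀ s₀ : ℕ) (δ₀ : ℝ),
    ∀ (s : ℕ) (δ : ℝ), s₀ ≤ s → δ₀ ≤ δ → ∀ (M : ℝ) (hM : 0 < M), ∃ ε > (0 : ℝ), ∃ C : ℝ,
      ∀ a : ℝ, |a| ≤ a₁ * M →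
      ∀ (D : InitialDataSet 𝓘(ℝ, E3) (Kerr.slice a M)) [D.metric.HasLeviCivita],
        InBall s δ M hM ε a D → ∀ 𝒟 : VacuumCauchyDevelopment D, 𝒟.IsMaximal →
        ∀ (M' a' : ℝ) (𝒟oc : Set 𝒟.carrier), Kerr.IsSubextremal M' a' →
          𝒟.toSpacetime.ConvergesToKerr 𝒟oc M' a' k₀ →
          |(|a'|) * M' - |a| * M| ≤ C * sqrtDist s δ M hM a D

/-! ## Registered stubs -/

theorem stub_uniformQualCapture : Sig.stub_uniformQualCapture := by
  sorry

theorem stub_bondiIdentification : Sig.stub_bondiIdentification := by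
  sorry

theorem stub_frozenCharges : Sig.stub_frozenCharges := by
  sorry

theorem stub_energyFluxSmall : Sig.stub_energyFluxSmall := by
  sorry

theorem stub_spinBudget : Sig.stub_spinBudget := by
  sorry

/-! ## The composition: budgets ⇒ modulus -/

section Composition

/-- **The budget algebra at one datum (PROVED).** Frozen charges `E_ADM = M`, `P_ADM = 0`, a canonical
foliation with final rest mass `M′`, the energy flux bound `E_rad ≤ C_E √d`, the spin budget
`||a′|M′ − |a|M| ≤ C_J √d`, the sign normalisation `0 ≤ a a′`, and the smallness `2 C_E √d ≤ M/2`
give the crux's modulus `|M′ − M| + |a′ − a| ≤ (2C_E + 2C_J/M + 4|a₁|C_E) √d`. -/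
theorem modulus_of_budgets {a₁ M a M' a' CE CJ sd : ℝ} (hM : 0 < M) (ha : |a| ≤ a₁ * M)
    (hsign : 0 ≤ a * a') {Erad : ℝ} (hErad : 0 ≤ Erad) (hmass : |M' - M| ≤ 2 * Erad)
    (hflux : Erad ≤ CE * sd) (hJ : |(|a'|) * M' - |a| * M| ≤ CJ * sd) (hsd : 0 ≤ sd)
    (hCE : 0 ≤ CE) (hCJ : 0 ≤ CJ) (hsmall : 2 * (CE * sd) ≤ M / 2) :
    |M' - M| + |a' - a| ≤ (2 * CE + 2 * CJ / M + 4 * |a₁| * CE) * sd := by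
  -- the final mass is at least `M/2`
  have hM' : M / 2 ≤ M' := by
    have := (abs_le.1 hmass).1
    linarith
  have hM'pos : 0 < M' := by linarith
  -- spin magnitudes
  have hspin : |(|a'| - |a|)| ≤ (CJ * sd + 2 * |(|a|)| * Erad) / M' :=
    spin_pinch hM'pos hmass hJ
  rw [abs_abs] at hspin
  have haa : |a| ≤ |a₁| * M := ha.trans (mul_le_mul_of_nonneg_right (le_abs_self a₁) hM.le)
  have hnum : CJ * sd + 2 * |a| * Erad ≤ (CJ + 2 * |a₁| * M * CE) * sd := by
    have h1 : 2 * |a| * Erad ≤ 2 * (|a₁| * M) * (CE * sd) :=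
      mul_le_mul (mul_le_mul_of_nonneg_left haa two_pos.le) hflux hErad (by positivity)
    nlinarith
  have hspin' : |(|a'| - |a|)| ≤ (CJ + 2 * |a₁| * M * CE) * sd / (M / 2) := by
    calc |(|a'| - |a|)| ≤ (CJ * sd + 2 * |a| * Erad) / M' := hspin
      _ ≤ (CJ + 2 * |a₁| * M * CE) * sd / M' := div_le_div_of_nonneg_right hnum hM'pos.le
      _ ≤ (CJ + 2 * |a₁| * M * CE) * sd / (M / 2) :=
          div_le_div_of_nonneg_left (by positivity) (by positivity) hM'
  rw [abs_sub_eq_abs_abs_sub_abs hsign]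
  have hmass' : |M' - M| ≤ 2 * CE * sd := by linarith
  have hMne : M ≠ 0 := hM.ne'
  calc |M' - M| + |(|a'| - |a|)| ≤ 2 * CE * sd + (CJ + 2 * |a₁| * M * CE) * sd / (M / 2) :=
        add_le_add hmass' hspin'
    _ = (2 * CE + 2 * CJ / M + 4 * |a₁| * CE) * sd := by
        field_simp
        ring

/-- **The line.** Stubs U, B, F, E, J imply the crux `BulkKerrCapture` BY NAME. Proof: `max` the
thresholds, `min` the basins (plus one shrink `(M / (4 C_E))²` so that `2 E_rad ≤ M/2`), run the five
stubs at one datum, and apply `abs_restMass_sub_le` + `modulus_of_budgets`. -/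
theorem BulkKerrCapture_of :
    Sig.stub_uniformQualCapture → Sig.stub_bondiIdentification → Sig.stub_frozenCharges →
      Sig.stub_energyFluxSmall → Sig.stub_spinBudget → BulkKerrCapture := by
  intro hU hB hF hE hJ
  rw [Negative.bulkKerrCapture_iff]
  intro _ _ a₁ ha₁
  -- thresholds
  obtain ⟨kB, sB, δB, HB⟩ := hB a₁ ha₁
  obtain ⟨sF, δF, HF⟩ := hF
  obtain ⟨sE, δE, HE⟩ := hE a₁ ha₁
  obtain ⟨kJ, sJ, δJ, HJ⟩ := hJ a₁ ha₁
  set k : ℕ := max kB kJ with hk_def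
  obtain ⟨sU, δU, HU⟩ := hU a₁ ha₁ k
  set s : ℕ := max sU (max sB (max sF (max sE sJ))) with hs_def
  set δ : ℝ := max δU (max δB (max δF (max δE δJ))) with hδ_def
  have hsU : sU ≤ s := le_max_left _ _
  have hsB : sB ≤ s := (le_max_left _ _).trans (le_max_right _ _)
  have hsF : sF ≤ s := ((le_max_left _ _).trans (le_max_right _ _)).trans (le_max_right _ _)
  have hsE : sE ≤ s :=
    (((le_max_left _ _).trans (le_max_right _ _)).trans (le_max_right _ _)).trans (le_max_right _ _)
  have hsJ : sJ ≤ s :=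
    (((le_max_right _ _).trans (le_max_right _ _)).trans (le_max_right _ _)).trans (le_max_right _ _)
  have hδU : δU ≤ δ := le_max_left _ _
  have hδB : δB ≤ δ := (le_max_left _ _).trans (le_max_right _ _)
  have hδF : δF ≤ δ := ((le_max_left _ _).trans (le_max_right _ _)).trans (le_max_right _ _)
  have hδE : δE ≤ δ :=
    (((le_max_left _ _).trans (le_max_right _ _)).trans (le_max_right _ _)).trans (le_max_right _ _)
  have hδJ : δJ ≤ δ :=
    (((le_max_right _ _).trans (le_max_right _ _)).trans (le_max_right _ _)).trans (le_max_right _ _)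
  refine ⟨s, δ, k, fun M hM ↦ ?_⟩
  -- basins and constants at mass `M`
  obtain ⟨εU, hεU, HU⟩ := HU s δ hsU hδU M hM
  obtain ⟨εB, hεB, HB⟩ := HB s δ hsB hδB M hM
  have HF := HF s δ hsF hδF M hM
  obtain ⟨εE, hεE, CE, HE⟩ := HE s δ hsE hδE M hM
  obtain ⟨εJ, hεJ, CJ, HJ⟩ := HJ s δ hsJ hδJ M hM
  set CE' : ℝ := max CE 1 with hCE'_def
  set CJ' : ℝ := max CJ 0 with hCJ'_def
  have hCE' : 0 < CE' := lt_of_lt_of_le one_pos (le_max_right _ _)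
  have hCJ' : 0 ≤ CJ' := le_max_right _ _
  set ε₀ : ℝ := (M / (4 * CE')) ^ 2 with hε₀_def
  have hε₀ : 0 < ε₀ := pow_pos (div_pos hM (by positivity)) 2
  set ε : ℝ := min εU (min εB (min εE (min εJ ε₀))) with hε_def
  have hε : 0 < ε := lt_min hεU (lt_min hεB (lt_min hεE (lt_min hεJ hε₀)))
  have hεU' : ε ≤ εU := min_le_left _ _
  have hεB' : ε ≤ εB := (min_le_right _ _).trans (min_le_left _ _)
  have hεE' : ε ≤ εE := ((min_le_right _ _).trans (min_le_right _ _)).trans (min_le_left _ _)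
  have hεJ' : ε ≤ εJ :=
    (((min_le_right _ _).trans (min_le_right _ _)).trans (min_le_right _ _)).trans (min_le_left _ _)
  have hε₀' : ε ≤ ε₀ :=
    (((min_le_right _ _).trans (min_le_right _ _)).trans (min_le_right _ _)).trans (min_le_right _ _)
  refine ⟨ε, hε, 2 * CE' + 2 * CJ' / M + 4 * |a₁| * CE', fun a ha ↦ ?_⟩
  -- one datum, one development
  intro D _ hvac hdist 𝒟 hmax
  have hball : ∀ {ε'}, ε ≤ ε' → InBall s δ M hM ε' a D := fun h ↦
    ⟨hvac, hdist.trans_le (ENNReal.ofReal_le_ofReal h)⟩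
  -- U: the sub-extremal, sign-normalised Kerr limit and far-completeness
  obtain ⟨M', a', 𝒟oc, hsub, hsign, hfar, hconv⟩ := HU a ha D hvac (hball hεU').2 𝒟 hmax
  -- B: canonical Bondi frame foliation with final rest mass `M'`
  obtain ⟨𝓕, hc, hrest⟩ :=
    HB a ha D (hball hεB') 𝒟 hmax M' a' 𝒟oc hsub (hconv.of_le (le_max_left _ _))
  -- F: frozen charges
  obtain ⟨hEADM, hPADM⟩ := HF a D hvac (hdist.trans_le le_top)
  -- E: energy flux; J: spin budget
  have hflux := HE a ha D (hball hεE') 𝒟 hmax 𝓕 hc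
  have hspin := HJ a ha D (hball hεJ') 𝒟 hmax M' a' 𝒟oc hsub (hconv.of_le (le_max_right _ _))
  -- the algebra
  obtain ⟨hmass, hErad⟩ := abs_restMass_sub_le hc hPADM hEADM hrest
  set d := InitialDataSet.dataWeightedSobolevEDist s δ D (Kerr.data M a M hM.le) with hd_def
  have hsd_def : sqrtDist s δ M hM a D = √d.toReal := rfl
  rw [hsd_def] at hflux hspin
  have hsd : 0 ≤ √d.toReal := Real.sqrt_nonneg _
  have hflux' : (Kerr.afEnd a M).admEnergy D - 𝓕.finalBondiEnergy ≤ CE' * √d.toReal :=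
    hflux.trans (mul_le_mul_of_nonneg_right (le_max_left _ _) hsd)
  have hspin' : |(|a'|) * M' - |a| * M| ≤ CJ' * √d.toReal :=
    hspin.trans (mul_le_mul_of_nonneg_right (le_max_left _ _) hsd)
  -- smallness: `d < ε ≤ ε₀ = (M / (4 CE'))²`, so `2 CE' √d ≤ M/2`
  have hdε₀ : d.toReal < ε₀ :=
    (ENNReal.lt_ofReal_iff_toReal_lt hdist.ne_top).1
      (hdist.trans_le (ENNReal.ofReal_le_ofReal hε₀'))
  have hsdlt : √d.toReal < M / (4 * CE') := by
    rw [hε₀_def] at hdε₀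
    exact (Real.sqrt_lt' (div_pos hM (by positivity))).2 hdε₀
  have hsmall : 2 * (CE' * √d.toReal) ≤ M / 2 := by
    have h4 : CE' * √d.toReal ≤ CE' * (M / (4 * CE')) :=
      mul_le_mul_of_nonneg_left hsdlt.le hCE'.le
    have : CE' * (M / (4 * CE')) = M / 4 := by field_simp
    linarith
  refine ⟨M', a', 𝒟oc, hsub, hfar, hconv, ?_⟩
  exact modulus_of_budgets hM ha hsign hErad hmass hflux' hspin' hsd hCE'.le hCJ' hsmall

/-- The skeleton instantiated: the crux modulo the five registered stubs. -/
theorem BulkKerrCapture_skeleton : BulkKerrCapture :=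
  BulkKerrCapture_of stub_uniformQualCapture stub_bondiIdentification stub_frozenCharges
    stub_energyFluxSmall stub_spinBudget

end Composition

end Summit.FinalStateConjecture.FinalStateConjecture.Cruxes.BulkKerrCapture.RecoilBudgetModulus

end
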